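import Mathlib
import HarnessLib

/-!
# Algebra of approximate dilations: composition with an approximate identity, and the inverse of an approximate identity

HONEST FRAMING: exact (Metropolis-corrected) sampling algorithms for lattice gauge theory;
figures of merit are autocorrelation/cost numbers at stated couplings and volumes; no
continuum-physics claim.

Venture `LatticeQCDFlow` (cell pub-lqcd), topic `Exactness`, FANOUT row 9 (eng-latcore; roadmap Step 3 to
multi-step HMC on the `cpn_2d` sphere family, HOME/eng-latcore/HANDOFF.md GEN-19: the trajectory readout is an
approximate dilation of the tangent space (`SphereTrajectoryDilation.lean`), the flat exponential chart an
approximate identity (`SphereExpChartFlatSide.lean`); the exponential coordinate of the position is the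
composition of the former with the INVERSE of the latter).  NEW WORK of the cell over Mathlib only (normed-space
triangle inequalities); nothing is cited as a fact; no number.

An APPROXIMATE DILATION by `τ` with defect `c` on a set `S` is a map `Ψ` with `‖Ψ p − Ψ p' − τ(p − p')‖ ≤ c‖p − p'‖`
for `p, p' ∈ S` (gen-18's `LocalDilationPushforward.lean` hypothesis); an approximate identity is the case `τ = 1`.

* `norm_sub_le_of_approx_set` — then `‖Ψ p − Ψ p'‖ ≤ (τ + c)‖p − p'‖` (`τ ≥ 0`).
* **`approx_comp`** — `g` an approximate identity with defect `η` on a set containing `Ψ '' S` ⇒ `g ∘ Ψ` is an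
  approximate dilation by `τ` with defect `c + η(τ + c)` on `S`.
* **`approx_inverse`** — `κ` an approximate identity with defect `η < 1` on `S`, `g` a right inverse of `κ` on `T`
  with values in `S` ⇒ `g` is an approximate identity with defect `η/(1 − η)` on `T`.

NOT CLAIMED: existence of the inverse (gen-18's `surjOn_closedBall_of_approxOn` gives surjectivity onto a ball),
measures (gen-18's `addHaar_inter_ball_le_of_approxOn`), anything sphere-specific.
-/

namespace Summit.Ventures.LatticeQCDFlow.Exactness

open Set

variable {V : Type*} [NormedAddCommGroup V] [NormedSpace ℝ V]

/-- An approximate dilation is Lipschitz with constant `τ + c` (`τ ≥ 0`). -/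
theorem norm_sub_le_of_approx_set {Ψ : V → V} {τ c : ℝ} {S : Set V} (hτ : 0 ≤ τ)
    (h : ∀ p ∈ S, ∀ p' ∈ S, ‖Ψ p - Ψ p' - τ • (p - p')‖ ≤ c * ‖p - p'‖) {p p' : V} (hp : p ∈ S) (hp' : p' ∈ S) :
    ‖Ψ p - Ψ p'‖ ≤ (τ + c) * ‖p - p'‖ := by
  have h1 := h p hp p' hp'
  calc ‖Ψ p - Ψ p'‖ = ‖(Ψ p - Ψ p' - τ • (p - p')) + τ • (p - p')‖ := by rw [sub_add_cancel]
    _ ≤ ‖Ψ p - Ψ p' - τ • (p - p')‖ + ‖τ • (p - p')‖ := norm_add_le _ _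
    _ ≤ c * ‖p - p'‖ + τ * ‖p - p'‖ := by
        rw [norm_smul, Real.norm_eq_abs, abs_of_nonneg hτ]; exact add_le_add h1 le_rfl
    _ = (τ + c) * ‖p - p'‖ := by ring

/-- **Composition with an approximate identity.**  If `Ψ` is an approximate dilation by `τ ≥ 0` with defect `c`
on `S` and `g` an approximate identity with defect `η ≥ 0` on a set `T ⊇ Ψ '' S`, then `g ∘ Ψ` is an approximate
dilation by `τ` with defect `c + η(τ + c)` on `S`. -/
theorem approx_comp {Ψ : V → V} {g : V → V} {τ c η : ℝ} {S T : Set V} (hτ : 0 ≤ τ) (hη : 0 ≤ η)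
    (hΨ : ∀ p ∈ S, ∀ p' ∈ S, ‖Ψ p - Ψ p' - τ • (p - p')‖ ≤ c * ‖p - p'‖)
    (hg : ∀ z ∈ T, ∀ z' ∈ T, ‖g z - g z' - (z - z')‖ ≤ η * ‖z - z'‖) (hST : MapsTo Ψ S T)
    {p p' : V} (hp : p ∈ S) (hp' : p' ∈ S) :
    ‖g (Ψ p) - g (Ψ p') - τ • (p - p')‖ ≤ (c + η * (τ + c)) * ‖p - p'‖ := by
  have h1 := hΨ p hp p' hp'
  have h2 := hg (Ψ p) (hST hp) (Ψ p') (hST hp')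
  have h3 := norm_sub_le_of_approx_set hτ hΨ hp hp'
  calc ‖g (Ψ p) - g (Ψ p') - τ • (p - p')‖
      = ‖(g (Ψ p) - g (Ψ p') - (Ψ p - Ψ p')) + (Ψ p - Ψ p' - τ • (p - p'))‖ := by congr 1; abel
    _ ≤ ‖g (Ψ p) - g (Ψ p') - (Ψ p - Ψ p')‖ + ‖Ψ p - Ψ p' - τ • (p - p')‖ := norm_add_le _ _
    _ ≤ η * ‖Ψ p - Ψ p'‖ + c * ‖p - p'‖ := add_le_add h2 h1
    _ ≤ η * ((τ + c) * ‖p - p'‖) + c * ‖p - p'‖ := by gcongr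
    _ = (c + η * (τ + c)) * ‖p - p'‖ := by ring

omit [NormedSpace ℝ V] in
/-- **The inverse of an approximate identity is an approximate identity.**  If `κ` has defect `η < 1` on `S`
(`τ = 1`) and `g : V → V` is a right inverse of `κ` on `T` with values in `S`, then `g` has defect `η/(1 − η)`
on `T`. -/
theorem approx_inverse {κ g : V → V} {η : ℝ} {S T : Set V} (hη0 : 0 ≤ η) (hη1 : η < 1)
    (hκ : ∀ y ∈ S, ∀ y' ∈ S, ‖κ y - κ y' - (y - y')‖ ≤ η * ‖y - y'‖)
    (hgS : MapsTo g T S) (hinv : ∀ z ∈ T, κ (g z) = z) {z z' : V} (hz : z ∈ T) (hz' : z' ∈ T) :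
    ‖g z - g z' - (z - z')‖ ≤ η / (1 - η) * ‖z - z'‖ := by
  have h1 := hκ (g z) (hgS hz) (g z') (hgS hz')
  rw [hinv z hz, hinv z' hz'] at h1
  -- `‖y − y'‖ ≤ ‖z − z'‖ + η‖y − y'‖`, hence `‖y − y'‖ ≤ ‖z − z'‖/(1 − η)`
  have h2 : ‖g z - g z'‖ ≤ ‖z - z'‖ + η * ‖g z - g z'‖ := by
    calc ‖g z - g z'‖ = ‖(z - z') - (z - z' - (g z - g z'))‖ := by congr 1; abel
      _ ≤ ‖z - z'‖ + ‖z - z' - (g z - g z')‖ := norm_sub_le _ _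
      _ ≤ ‖z - z'‖ + η * ‖g z - g z'‖ := by gcongr
  have h1η : 0 < 1 - η := by linarith
  have h3 : ‖g z - g z'‖ ≤ ‖z - z'‖ / (1 - η) := by
    rw [le_div_iff₀ h1η]; nlinarith
  calc ‖g z - g z' - (z - z')‖ = ‖z - z' - (g z - g z')‖ := by rw [← norm_neg]; congr 1; abel
    _ ≤ η * ‖g z - g z'‖ := h1
    _ ≤ η * (‖z - z'‖ / (1 - η)) := by gcongr
    _ = η / (1 - η) * ‖z - z'‖ := by ring

end Summit.Ventures.LatticeQCDFlow.Exactness
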